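import Summits.KontsevichZagierPeriods.KontsevichZagierPeriods.Theorems.TerasomaMultiplicationBetaCancellationOfAyoubPiCancellation
import Summits.KontsevichZagierPeriods.KontsevichZagierPeriods.Theorems.TerasomaMultiplicationBetaCancellationStubRegionRestrict
import Summits.KontsevichZagierPeriods.KontsevichZagierPeriods.Theorems.TerasomaMultiplicationBetaCancellationStubPiMulRegion
import Summits.KontsevichZagierPeriods.KontsevichZagierPeriods.Theorems.TerasomaMultiplicationBetaCancellationStubSquareFinish

/-!
# Region descent: `π`-cancellation for certificates respecting a region of BOTH disc coordinates

Cycle 3 of the crux lead seat c8 (`--supports` stmt-KontsevichZagierPeriods-13633, line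
`dirichlet-companion-to-pi`). Fix a region `T ⊆ ℝ²` whose cylinders `{z | (z 0, z 1) ∈ T}` are
`ℚ`-semialgebraic in every dimension `≥ 2`. The **`T`-respecting generators** (inline, no definition)
are: all additivity moves, the changes of variables `Φ` of `(n+2)`-dimensional representations with
`(Φ x 0, Φ x 1) ∈ T ↔ (x 0, x 1) ∈ T` on the domain, and the Newton–Leibniz moves over a base of
dimension `≥ 2` (both disc coordinates are base coordinates).

* `regionDescent` — **MASTER THEOREM (two coordinates)**: if the disc piece `D ∩ T` (a representation
  `D_T` with domain `piDisc ∩ {(z 0, z 1) ∈ T}`, integrand `1`) FINISHES — `[D_T]·c ∈ relations` and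
  `[π]·c ∈ relations` force `c ∈ relations` — then `π`-cancellation (item 0540) holds for every
  certificate in the closure of the `T`-respecting generators (`stub_regionRestrict`, p121362, +
  `regionLift`);
* `ayoubPiCancellation_iff_regionReduction` — conversely `[π]·relations` is `T`-respecting for EVERY `T`
  (`stub_piMulRegion`, p121355), so item 0540 ⟺ `T`-reduction for every finishing `T`;
* THE INSCRIBED SQUARE `Q = [-1/2,1/2]²` finishes WITHOUT Archimedes: `D ∩ Q = Q` is worth the
  constant `1` against any factor (`stub_squareFinish`, p121416: translation + two Newton–Leibniz
  moves), whence `region_ayoubPiCancellation_square` and `betaCancellation_iff_squareReduction`: the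
  crux ⟺ every relation among disc multiples can be re-certified with substitutions preserving the
  solid square cylinder `Q × ℝᵏ` and Newton–Leibniz over bases of dimension `≥ 2`.

This class is incomparable with the side classes of `…SideDescentInstances.lean`; together they are
the complete output of the restriction method (any compatible family of cylinders descends; what
remains of item 0540 is a substitution moving mass across the boundary of ONE such cylinder).
-/

noncomputable section

-- `Summit.KontsevichZagierPeriods.KontsevichZagierPeriods.…` is the tree's mandated layout (single-conjunct summit).
set_option linter.dupNamespace false

namespace Summit.KontsevichZagierPeriods.KontsevichZagierPeriods.BetaCancellationLine

open Set
open Literature.NumberTheory.Transcendental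
open Literature.NumberTheory.Transcendental.KZ

/-! ### Region restrictions exist; the region closure consists of relations -/

/-- **Region restrictions exist**: for a region `T` with `ℚ`-semialgebraic cylinders there is an
additive `H : FormalRep →+ FormalRep` killing the generators of dimension `0` and `1` and restricting
every representation of dimension `≥ 2` to `{(z 0, z 1) ∈ T}`. [folklore] -/
theorem exists_regionRestrict (T : Set (ℝ × ℝ))
    (hT : ∀ k : ℕ, Literature.ModelTheory.ExponentialFields.IsSemialgebraic ℚ
      {z : Fin (k + 2) → ℝ | (z 0, z 1) ∈ T}) :
    ∃ H : FormalRep →+ FormalRep,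
      (∀ r : IntegralRep 0, H (of r) = 0) ∧ (∀ r : IntegralRep 1, H (of r) = 0) ∧
      (∀ (k : ℕ) (r s : IntegralRep (k + 2)), s.domain = r.domain ∩ {z | (z 0, z 1) ∈ T} →
          s.integrand = r.integrand → H (of r) = of s) := by
  classical
  refine ⟨FreeAbelianGroup.lift (fun s : (Σ n, IntegralRep n) => match s with
      | ⟨0, _⟩ => 0
      | ⟨1, _⟩ => 0
      | ⟨k + 2, r⟩ => of (r.restrict (r.domain ∩ {z | (z 0, z 1) ∈ T})
          (r.isSemialgebraic_domain.inter (hT k)) inter_subset_left)), ?_, ?_, ?_⟩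
  · intro r
    show FreeAbelianGroup.lift _ (FreeAbelianGroup.of _) = 0
    rw [FreeAbelianGroup.lift_apply_of]
  · intro r
    show FreeAbelianGroup.lift _ (FreeAbelianGroup.of _) = 0
    rw [FreeAbelianGroup.lift_apply_of]
  · intro k r s hd hi
    show FreeAbelianGroup.lift _ (FreeAbelianGroup.of _) = of s
    rw [FreeAbelianGroup.lift_apply_of]
    exact congrArg of (IntegralRep.ext' (by rw [IntegralRep.domain_restrict, hd])
      (by rw [IntegralRep.integrand_restrict, hi]))

/-- The `T`-respecting generators are relations, so their closure is `≤ relations`. [folklore] -/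
theorem regionClosure_le_relations (T : Set (ℝ × ℝ)) :
    AddSubgroup.closure (domainAddRel ∪ integrandAddRel ∪
      {x | ∃ (n : ℕ) (r r' : IntegralRep (n + 2)) (Φ : (Fin (n + 2) → ℝ) → (Fin (n + 2) → ℝ))
          (Φ' : (Fin (n + 2) → ℝ) → (Fin (n + 2) → ℝ) →L[ℝ] (Fin (n + 2) → ℝ)),
        IsSemialgebraicMapOn ℚ r.domain Φ ∧ (∀ x ∈ r.domain, HasFDerivWithinAt Φ (Φ' x) r.domain x) ∧
        Set.InjOn Φ r.domain ∧ r'.domain = Φ '' r.domain ∧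
        (∀ x ∈ r.domain, r.integrand x = r'.integrand (Φ x) * |(Φ' x).det|) ∧
        (∀ x ∈ r.domain, (Φ x 0, Φ x 1) ∈ T ↔ (x 0, x 1) ∈ T) ∧ x = of r - of r'} ∪
      {x | x ∈ newtonLeibnizRel ∧ ∃ (n : ℕ) (r : IntegralRep (n + 3)) (r' : IntegralRep (n + 2)),
        x = of r - of r'}) ≤ relations := by
  refine (AddSubgroup.closure_le relations).mpr ?_
  rintro y (((hy | hy) | hy) | hy)
  · exact domainAddRel_subset_relations hy
  · exact integrandAddRel_subset_relations hy
  · obtain ⟨k, r, r', Φ, Φ', hΦ, hΦ', hinj, hdom, hf, -, rfl⟩ := hy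
    exact changeOfVariablesRel_subset_relations ⟨k + 2, r, r', Φ, Φ', hΦ, hΦ', hinj, hdom, hf, rfl⟩
  · exact newtonLeibnizRel_subset_relations hy.1

/-! ### Region lift: on the disc family a region restriction computes `[D_T] * c` -/

/-- **The region restriction of the pinned family is the reindexed `D_T × t`.** [folklore] -/
theorem pinned_regionRestrict_eq_reindex
    (P : ∀ n : ℕ, IntegralRep n → IntegralRep (n + 2))
    (hP : ∀ (n : ℕ) (r : IntegralRep n),
      (P n r).domain = {z : Fin (n + 2) → ℝ | z 0 ^ 2 + z 1 ^ 2 ≤ 1 ∧ (fun i : Fin n => z i.succ.succ) ∈ r.domain} ∧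
      (P n r).integrand = fun z => r.integrand (fun i : Fin n => z i.succ.succ))
    (T : Set (ℝ × ℝ)) {DT : IntegralRep 2} (hDT : DT.domain = piDisc ∩ {z | (z 0, z 1) ∈ T})
    (hDT1 : DT.integrand = fun _ => 1) (m : ℕ) (t : IntegralRep m) {s : IntegralRep (m + 2)}
    (hs : s.domain = (P m t).domain ∩ {z | (z 0, z 1) ∈ T}) (hsi : s.integrand = (P m t).integrand) :
    s = (DT.prod t).reindex (finCongr (Nat.add_comm 2 m)) := by
  refine IntegralRep.ext' ?_ ?_
  · rw [hs]
    ext z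
    simp only [(hP m t).1, IntegralRep.reindex_domain, IntegralRep.prod_domain,
      IntegralRep.mem_prodDomain, hDT, mem_inter_iff, mem_setOf_eq, mem_piDisc,
      piIndex_castAdd_zero, piIndex_castAdd_one, piIndex_natAdd]
    exact and_right_comm
  · rw [hsi]
    funext z
    simp only [(hP m t).2, IntegralRep.reindex_integrand, IntegralRep.prod_integrand_eq,
      IntegralRep.prodFun, hDT1, one_mul, piIndex_natAdd]

/-- **Region lift**: `[D_T] * c − H (lift (of ∘ P) c) ∈ relations` for any region restriction `H`
(additivity in `c`; on a generator one coordinate relabelling, `KZ.of_sub_of_reindex_mem_relations`).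
[folklore] -/
theorem regionLift
    (P : ∀ n : ℕ, IntegralRep n → IntegralRep (n + 2))
    (hP : ∀ (n : ℕ) (r : IntegralRep n),
      (P n r).domain = {z : Fin (n + 2) → ℝ | z 0 ^ 2 + z 1 ^ 2 ≤ 1 ∧ (fun i : Fin n => z i.succ.succ) ∈ r.domain} ∧
      (P n r).integrand = fun z => r.integrand (fun i : Fin n => z i.succ.succ))
    (T : Set (ℝ × ℝ))
    (hT : ∀ k : ℕ, Literature.ModelTheory.ExponentialFields.IsSemialgebraic ℚ
      {z : Fin (k + 2) → ℝ | (z 0, z 1) ∈ T})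
    {DT : IntegralRep 2} (hDT : DT.domain = piDisc ∩ {z | (z 0, z 1) ∈ T})
    (hDT1 : DT.integrand = fun _ => 1)
    (H : FormalRep →+ FormalRep)
    (hpin : ∀ (k : ℕ) (r s : IntegralRep (k + 2)), s.domain = r.domain ∩ {z | (z 0, z 1) ∈ T} →
      s.integrand = r.integrand → H (of r) = of s)
    (c : FormalRep) :
    of DT * c - H (FreeAbelianGroup.lift (fun s : (Σ n, IntegralRep n) => of (P s.1 s.2)) c) ∈
      relations := by
  induction c using FreeAbelianGroup.induction_on with
  | zero => simp [relations.zero_mem]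
  | of x =>
    obtain ⟨m, t⟩ := x
    rw [FreeAbelianGroup.lift_apply_of]
    obtain ⟨s, hs, hsi⟩ := regionRestrict_exists_restrict (hT m) (P m t)
    change of DT * of t - H (of (P m t)) ∈ relations
    rw [hpin m (P m t) s hs hsi, pinned_regionRestrict_eq_reindex P hP T hDT hDT1 m t hs hsi,
      of_mul_of]
    exact of_sub_of_reindex_mem_relations _ _
  | neg x ih =>
    rw [mul_neg, map_neg, map_neg, ← neg_sub']
    exact relations.neg_mem ih
  | add x y hx hy =>
    rw [mul_add, map_add, map_add, ← sub_add_sub_comm]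
    exact relations.add_mem hx hy

/-! ### The master theorem in two coordinates -/

/-- **REGION DESCENT (master theorem of the restriction method, two coordinates).** Let `T ⊆ ℝ²`
have `ℚ`-semialgebraic cylinders and let the disc piece `D_T` finish. Then `π`-cancellation holds for
every pinned disc family `P` and every certificate `lift (of ∘ P) c` in the closure of the
`T`-respecting generators. [folklore] -/
theorem regionDescent :
    ∀ (T : Set (ℝ × ℝ)), (∀ k : ℕ, Literature.ModelTheory.ExponentialFields.IsSemialgebraic ℚ {z : Fin (k + 2) → ℝ | (z 0, z 1) ∈ T}) → ∀ {DT : IntegralRep 2}, DT.domain = piDisc ∩ {z | (z 0, z 1) ∈ T} → (DT.integrand = fun _ => 1) → (∀ c : FormalRep, of DT * c ∈ relations → of piRep * c ∈ relations → c ∈ relations) → ∀ (P : ∀ n : ℕ, IntegralRep n → IntegralRep (n + 2)), (∀ (n : ℕ) (r : IntegralRep n), (P n r).domain = {z : Fin (n + 2) → ℝ | z 0 ^ 2 + z 1 ^ 2 ≤ 1 ∧ (fun i : Fin n => z i.succ.succ) ∈ r.domain} ∧ (P n r).integrand = fun z => r.integrand (fun i : Fin n => z i.succ.succ)) → ∀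 (c : FormalRep), FreeAbelianGroup.lift (fun s : (Σ n, IntegralRep n) => of (P s.1 s.2)) c ∈ AddSubgroup.closure (domainAddRel ∪ integrandAddRel ∪ {x | ∃ (n : ℕ) (r r' : IntegralRep (n + 2)) (Φ : (Fin (n + 2) → ℝ) → (Fin (n + 2) → ℝ)) (Φ' : (Fin (n + 2) → ℝ) → (Fin (n + 2) → ℝ) →L[ℝ] (Fin (n + 2) → ℝ)), IsSemialgebraicMapOn ℚ r.domain Φ ∧ (∀ x ∈ r.domain, HasFDerivWithinAt Φ (Φ' x) r.domain x) ∧ Set.InjOn Φ r.domain ∧ r'.domain = Φ '' r.domain ∧ (∀ x ∈ r.domain, r.integrand x = r'.integrand (Φ x) * |(Φ' x).det|) ∧ (∀ x ∈ r.domain, (Φ x 0, Φ x 1) ∈ T ↔ (x 0, x 1) ∈ T) ∧ x = of r - of r'} ∪ {x | x ∈ newtonLeibnizRel ∧ ∃ (n : ℕ) (r : IntegralRep (n + 3)) (r' : IntegralRep (n + 2)), x = of r - of r'}) → c ∈ relations := by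
  intro T hT DT hDT hDT1 hfin P hP c hc
  obtain ⟨H, h0, h1, hpin⟩ := exists_regionRestrict T hT
  have hH := stub_regionRestrict T hT H h0 h1 hpin _ hc
  have hL := regionLift P hP T hT hDT hDT1 H hpin c
  have hS : of DT * c ∈ relations := by
    simpa using relations.add_mem hL hH
  have hπ : of piRep * c ∈ relations := by
    have h3 := piRep_mul_sub_lift_mem_relations P hP c
    have h4 := regionClosure_le_relations T hc
    simpa using relations.add_mem h3 h4
  exact hfin c hS hπ

/-- **Item 0540 ⟺ `T`-REDUCTION, for every finishing region `T`.** [folklore] -/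
theorem ayoubPiCancellation_iff_regionReduction (T : Set (ℝ × ℝ))
    (hT : ∀ k : ℕ, Literature.ModelTheory.ExponentialFields.IsSemialgebraic ℚ
      {z : Fin (k + 2) → ℝ | (z 0, z 1) ∈ T})
    {DT : IntegralRep 2} (hDT : DT.domain = piDisc ∩ {z | (z 0, z 1) ∈ T})
    (hDT1 : DT.integrand = fun _ => 1)
    (hfin : ∀ c : FormalRep, of DT * c ∈ relations → of piRep * c ∈ relations → c ∈ relations) :
    Summit.KontsevichZagierPeriods.KontsevichZagierPeriods.Theses.AyoubSpecialisation.AyoubPiCancellation ↔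
    ∀ (P : ∀ n : ℕ, IntegralRep n → IntegralRep (n + 2)),
      (∀ (n : ℕ) (r : IntegralRep n), (P n r).domain = {z : Fin (n + 2) → ℝ | z 0 ^ 2 + z 1 ^ 2 ≤ 1 ∧ (fun i : Fin n => z i.succ.succ) ∈ r.domain} ∧ (P n r).integrand = fun z => r.integrand (fun i : Fin n => z i.succ.succ)) →
      ∀ c : FormalRep,
        FreeAbelianGroup.lift (fun s : (Σ n, IntegralRep n) => of (P s.1 s.2)) c ∈ relations →
        FreeAbelianGroup.lift (fun s : (Σ n, IntegralRep n) => of (P s.1 s.2)) c ∈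
          AddSubgroup.closure (domainAddRel ∪ integrandAddRel ∪
          {x | ∃ (n : ℕ) (r r' : IntegralRep (n + 2)) (Φ : (Fin (n + 2) → ℝ) → (Fin (n + 2) → ℝ))
              (Φ' : (Fin (n + 2) → ℝ) → (Fin (n + 2) → ℝ) →L[ℝ] (Fin (n + 2) → ℝ)),
            IsSemialgebraicMapOn ℚ r.domain Φ ∧ (∀ x ∈ r.domain, HasFDerivWithinAt Φ (Φ' x) r.domain x) ∧
            Set.InjOn Φ r.domain ∧ r'.domain = Φ '' r.domain ∧
            (∀ x ∈ r.domain, r.integrand x = r'.integrand (Φ x) * |(Φ' x).det|) ∧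
            (∀ x ∈ r.domain, (Φ x 0, Φ x 1) ∈ T ↔ (x 0, x 1) ∈ T) ∧ x = of r - of r'} ∪
          {x | x ∈ newtonLeibnizRel ∧ ∃ (n : ℕ) (r : IntegralRep (n + 3)) (r' : IntegralRep (n + 2)),
            x = of r - of r'}) := by
  constructor
  · intro h P hP c hc
    exact stub_piMulRegion T P hP c (h P hP c hc)
  · intro h P hP c hc
    exact regionDescent T hT hDT hDT1 hfin P hP c (h P hP c hc)

/-! ### The inscribed square -/

/-- `{z | z i ≤ q}` is `ℚ`-semialgebraic (`q` rational). [folklore] -/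
theorem isSemialgebraic_setOf_apply_le_ratCast (k : ℕ) (i : Fin (k + 2)) (q : ℚ) :
    Literature.ModelTheory.ExponentialFields.IsSemialgebraic ℚ
      {z : Fin (k + 2) → ℝ | z i ≤ (q : ℝ)} := by
  have h := Literature.ModelTheory.ExponentialFields.isSemialgebraic_setOf_eval_le
    (k := ℚ) (R := ℝ) (MvPolynomial.X i) (MvPolynomial.C q)
  have e : {z : Fin (k + 2) → ℝ | z i ≤ (q : ℝ)} =
      {x : Fin (k + 2) → ℝ | MvPolynomial.aeval x (MvPolynomial.X i : MvPolynomial (Fin (k + 2)) ℚ) ≤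
        MvPolynomial.aeval x (MvPolynomial.C q : MvPolynomial (Fin (k + 2)) ℚ)} := by
    ext z
    simp only [mem_setOf_eq, MvPolynomial.aeval_X, MvPolynomial.aeval_C, eq_ratCast]
  rw [e]
  exact h

/-- `{z | q ≤ z i}` is `ℚ`-semialgebraic (`q` rational). [folklore] -/
theorem isSemialgebraic_setOf_ratCast_le_apply (k : ℕ) (i : Fin (k + 2)) (q : ℚ) :
    Literature.ModelTheory.ExponentialFields.IsSemialgebraic ℚ
      {z : Fin (k + 2) → ℝ | (q : ℝ) ≤ z i} := by
  have h := Literature.ModelTheory.ExponentialFields.isSemialgebraic_setOf_eval_le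
    (k := ℚ) (R := ℝ) (MvPolynomial.C q) (MvPolynomial.X i)
  have e : {z : Fin (k + 2) → ℝ | (q : ℝ) ≤ z i} =
      {x : Fin (k + 2) → ℝ | MvPolynomial.aeval x (MvPolynomial.C q : MvPolynomial (Fin (k + 2)) ℚ) ≤
        MvPolynomial.aeval x (MvPolynomial.X i : MvPolynomial (Fin (k + 2)) ℚ)} := by
    ext z
    simp only [mem_setOf_eq, MvPolynomial.aeval_X, MvPolynomial.aeval_C, eq_ratCast]
  rw [e]
  exact h

/-- The solid cylinder over the inscribed square `Q = [-1/2,1/2]²` is `ℚ`-semialgebraic in every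
dimension `≥ 2` (four polynomial inequalities). [folklore] -/
theorem isSemialgebraic_setOf_pair_mem_square (k : ℕ) :
    Literature.ModelTheory.ExponentialFields.IsSemialgebraic ℚ
      {z : Fin (k + 2) → ℝ | (z 0, z 1) ∈ Set.Icc (-1/2 : ℝ) (1/2) ×ˢ Set.Icc (-1/2 : ℝ) (1/2)} := by
  have e : {z : Fin (k + 2) → ℝ | (z 0, z 1) ∈ Set.Icc (-1/2 : ℝ) (1/2) ×ˢ Set.Icc (-1/2 : ℝ) (1/2)} =
      ({z : Fin (k + 2) → ℝ | ((-1/2 : ℚ) : ℝ) ≤ z 0} ∩ {z : Fin (k + 2) → ℝ | z 0 ≤ ((1/2 : ℚ) : ℝ)}) ∩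
        ({z : Fin (k + 2) → ℝ | ((-1/2 : ℚ) : ℝ) ≤ z 1} ∩ {z : Fin (k + 2) → ℝ | z 1 ≤ ((1/2 : ℚ) : ℝ)}) := by
    ext z
    simp only [mem_setOf_eq, mem_prod, mem_Icc, mem_inter_iff]
    push_cast
    exact Iff.rfl
  rw [e]
  exact ((isSemialgebraic_setOf_ratCast_le_apply k 0 (-1/2)).inter
    (isSemialgebraic_setOf_apply_le_ratCast k 0 (1/2))).inter
    ((isSemialgebraic_setOf_ratCast_le_apply k 1 (-1/2)).inter
      (isSemialgebraic_setOf_apply_le_ratCast k 1 (1/2)))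

/-- **`π`-cancellation for certificates respecting the inscribed square** `Q = [-1/2,1/2]²` in the two
disc coordinates (substitutions preserve the solid cylinder `Q × ℝᵏ`; Newton–Leibniz over bases of
dimension `≥ 2`): `[D ∩ Q]·c = [Q]·c ∼ c` finishes by `stub_squareFinish`, no Archimedes. [folklore] -/
theorem region_ayoubPiCancellation_square :
    ∀ (P : ∀ n : ℕ, IntegralRep n → IntegralRep (n + 2)), (∀ (n : ℕ) (r : IntegralRep n), (P n r).domain = {z : Fin (n + 2) → ℝ | z 0 ^ 2 + z 1 ^ 2 ≤ 1 ∧ (fun i : Fin n => z i.succ.succ) ∈ r.domain} ∧ (P n r).integrand = fun z => r.integrand (fun i : Fin n => z i.succ.succ)) → ∀ (c : FormalRep), FreeAbelianGroup.lift (fun s : (Σ n, IntegralRep n) => of (P s.1 s.2)) c ∈ AddSubgroup.closure (domainAddRel ∪ integrandAddRel ∪ {x | ∃ (n : ℕ) (r r' : IntegralRep (n + 2)) (Φ : (Fin (n + 2) → ℝ) → (Fin (n + 2) → ℝ)) (Φ' : (Fin (n + 2) → ℝ) → (Fin (n + 2) → ℝ) →L[ℝ] (Fin (n + 2) → ℝ)),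 IsSemialgebraicMapOn ℚ r.domain Φ ∧ (∀ x ∈ r.domain, HasFDerivWithinAt Φ (Φ' x) r.domain x) ∧ Set.InjOn Φ r.domain ∧ r'.domain = Φ '' r.domain ∧ (∀ x ∈ r.domain, r.integrand x = r'.integrand (Φ x) * |(Φ' x).det|) ∧ (∀ x ∈ r.domain, (Φ x 0, Φ x 1) ∈ Set.Icc (-1/2 : ℝ) (1/2) ×ˢ Set.Icc (-1/2 : ℝ) (1/2) ↔ (x 0, x 1) ∈ Set.Icc (-1/2 : ℝ) (1/2) ×ˢ Set.Icc (-1/2 : ℝ) (1/2)) ∧ x = of r - of r'} ∪ {x | x ∈ newtonLeibnizRel ∧ ∃ (n : ℕ) (r : IntegralRep (n + 3)) (r' : IntegralRep (n + 2)), x = of r - of r'}) → c ∈ relations :=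
  regionDescent (Set.Icc (-1/2 : ℝ) (1/2) ×ˢ Set.Icc (-1/2 : ℝ) (1/2)) isSemialgebraic_setOf_pair_mem_square
    (DT := piRep.restrict (piDisc ∩ {z | (z 0, z 1) ∈ Set.Icc (-1/2 : ℝ) (1/2) ×ˢ Set.Icc (-1/2 : ℝ) (1/2)})
      (isSemialgebraic_piDisc.inter (isSemialgebraic_setOf_pair_mem_square 0)) inter_subset_left)
    rfl rfl (fun c h _ => stub_squareFinish _ rfl rfl c h)

/-- **Item 0540 ⟺ SQUARE REDUCTION**: `AyoubPiCancellation` holds iff every relation among disc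
multiples can be re-certified with substitutions preserving the solid square cylinder and
Newton–Leibniz over bases of dimension `≥ 2`. [folklore] -/
theorem ayoubPiCancellation_iff_squareReduction :
    Summit.KontsevichZagierPeriods.KontsevichZagierPeriods.Theses.AyoubSpecialisation.AyoubPiCancellation ↔
    ∀ (P : ∀ n : ℕ, IntegralRep n → IntegralRep (n + 2)),
      (∀ (n : ℕ) (r : IntegralRep n), (P n r).domain = {z : Fin (n + 2) → ℝ | z 0 ^ 2 + z 1 ^ 2 ≤ 1 ∧ (fun i : Fin n => z i.succ.succ) ∈ r.domain} ∧ (P n r).integrand = fun z => r.integrand (fun i : Fin n => z i.succ.succ)) →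
      ∀ c : FormalRep,
        FreeAbelianGroup.lift (fun s : (Σ n, IntegralRep n) => of (P s.1 s.2)) c ∈ relations →
        FreeAbelianGroup.lift (fun s : (Σ n, IntegralRep n) => of (P s.1 s.2)) c ∈
          AddSubgroup.closure (domainAddRel ∪ integrandAddRel ∪
          {x | ∃ (n : ℕ) (r r' : IntegralRep (n + 2)) (Φ : (Fin (n + 2) → ℝ) → (Fin (n + 2) → ℝ))
              (Φ' : (Fin (n + 2) → ℝ) → (Fin (n + 2) → ℝ) →L[ℝ] (Fin (n + 2) → ℝ)),
            IsSemialgebraicMapOn ℚ r.domain Φ ∧ (∀ x ∈ r.domain, HasFDerivWithinAt Φ (Φ' x) r.domain x) ∧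
            Set.InjOn Φ r.domain ∧ r'.domain = Φ '' r.domain ∧
            (∀ x ∈ r.domain, r.integrand x = r'.integrand (Φ x) * |(Φ' x).det|) ∧
            (∀ x ∈ r.domain, (Φ x 0, Φ x 1) ∈ Set.Icc (-1/2 : ℝ) (1/2) ×ˢ Set.Icc (-1/2 : ℝ) (1/2) ↔
              (x 0, x 1) ∈ Set.Icc (-1/2 : ℝ) (1/2) ×ˢ Set.Icc (-1/2 : ℝ) (1/2)) ∧ x = of r - of r'} ∪
          {x | x ∈ newtonLeibnizRel ∧ ∃ (n : ℕ) (r : IntegralRep (n + 3)) (r' : IntegralRep (n + 2)),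
            x = of r - of r'}) :=
  ayoubPiCancellation_iff_regionReduction (Set.Icc (-1/2 : ℝ) (1/2) ×ˢ Set.Icc (-1/2 : ℝ) (1/2))
    isSemialgebraic_setOf_pair_mem_square
    (DT := piRep.restrict (piDisc ∩ {z | (z 0, z 1) ∈ Set.Icc (-1/2 : ℝ) (1/2) ×ˢ Set.Icc (-1/2 : ℝ) (1/2)})
      (isSemialgebraic_piDisc.inter (isSemialgebraic_setOf_pair_mem_square 0)) inter_subset_left)
    rfl rfl (fun c h _ => stub_squareFinish _ rfl rfl c h)

/-- **`KZ.PiCancellation` ⟺ SQUARE REDUCTION** (through `stub_ayoubBridge`). [folklore] -/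
theorem piCancellation_iff_squareReduction :
    Literature.NumberTheory.Transcendental.KZ.PiCancellation ↔
    ∀ (P : ∀ n : ℕ, IntegralRep n → IntegralRep (n + 2)),
      (∀ (n : ℕ) (r : IntegralRep n), (P n r).domain = {z : Fin (n + 2) → ℝ | z 0 ^ 2 + z 1 ^ 2 ≤ 1 ∧ (fun i : Fin n => z i.succ.succ) ∈ r.domain} ∧ (P n r).integrand = fun z => r.integrand (fun i : Fin n => z i.succ.succ)) →
      ∀ c : FormalRep,
        FreeAbelianGroup.lift (fun s : (Σ n, IntegralRep n) => of (P s.1 s.2)) c ∈ relations →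
        FreeAbelianGroup.lift (fun s : (Σ n, IntegralRep n) => of (P s.1 s.2)) c ∈
          AddSubgroup.closure (domainAddRel ∪ integrandAddRel ∪
          {x | ∃ (n : ℕ) (r r' : IntegralRep (n + 2)) (Φ : (Fin (n + 2) → ℝ) → (Fin (n + 2) → ℝ))
              (Φ' : (Fin (n + 2) → ℝ) → (Fin (n + 2) → ℝ) →L[ℝ] (Fin (n + 2) → ℝ)),
            IsSemialgebraicMapOn ℚ r.domain Φ ∧ (∀ x ∈ r.domain, HasFDerivWithinAt Φ (Φ' x) r.domain x) ∧
            Set.InjOn Φ r.domain ∧ r'.domain = Φ '' r.domain ∧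
            (∀ x ∈ r.domain, r.integrand x = r'.integrand (Φ x) * |(Φ' x).det|) ∧
            (∀ x ∈ r.domain, (Φ x 0, Φ x 1) ∈ Set.Icc (-1/2 : ℝ) (1/2) ×ˢ Set.Icc (-1/2 : ℝ) (1/2) ↔
              (x 0, x 1) ∈ Set.Icc (-1/2 : ℝ) (1/2) ×ˢ Set.Icc (-1/2 : ℝ) (1/2)) ∧ x = of r - of r'} ∪
          {x | x ∈ newtonLeibnizRel ∧ ∃ (n : ℕ) (r : IntegralRep (n + 3)) (r' : IntegralRep (n + 2)),
            x = of r - of r'}) :=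
  stub_ayoubBridge.symm.trans ayoubPiCancellation_iff_squareReduction

/-- **THE CRUX ⟺ SQUARE REDUCTION**: `BetaCancellation` (stmt-13633) holds iff every relation among
disc multiples can be re-certified with substitutions preserving the solid cylinder over the inscribed
square `[-1/2,1/2]²` (and Newton–Leibniz over bases of dimension `≥ 2`) — a second, incomparable form
of the open core after seat c8 (≡ item 0540). [folklore] -/
theorem betaCancellation_iff_squareReduction :
    Summit.KontsevichZagierPeriods.KontsevichZagierPeriods.Theses.TerasomaMultiplication.BetaCancellation ↔
    ∀ (P : ∀ n : ℕ, IntegralRep n → IntegralRep (n + 2)),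
      (∀ (n : ℕ) (r : IntegralRep n), (P n r).domain = {z : Fin (n + 2) → ℝ | z 0 ^ 2 + z 1 ^ 2 ≤ 1 ∧ (fun i : Fin n => z i.succ.succ) ∈ r.domain} ∧ (P n r).integrand = fun z => r.integrand (fun i : Fin n => z i.succ.succ)) →
      ∀ c : FormalRep,
        FreeAbelianGroup.lift (fun s : (Σ n, IntegralRep n) => of (P s.1 s.2)) c ∈ relations →
        FreeAbelianGroup.lift (fun s : (Σ n, IntegralRep n) => of (P s.1 s.2)) c ∈
          AddSubgroup.closure (domainAddRel ∪ integrandAddRel ∪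
          {x | ∃ (n : ℕ) (r r' : IntegralRep (n + 2)) (Φ : (Fin (n + 2) → ℝ) → (Fin (n + 2) → ℝ))
              (Φ' : (Fin (n + 2) → ℝ) → (Fin (n + 2) → ℝ) →L[ℝ] (Fin (n + 2) → ℝ)),
            IsSemialgebraicMapOn ℚ r.domain Φ ∧ (∀ x ∈ r.domain, HasFDerivWithinAt Φ (Φ' x) r.domain x) ∧
            Set.InjOn Φ r.domain ∧ r'.domain = Φ '' r.domain ∧
            (∀ x ∈ r.domain, r.integrand x = r'.integrand (Φ x) * |(Φ' x).det|) ∧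
            (∀ x ∈ r.domain, (Φ x 0, Φ x 1) ∈ Set.Icc (-1/2 : ℝ) (1/2) ×ˢ Set.Icc (-1/2 : ℝ) (1/2) ↔
              (x 0, x 1) ∈ Set.Icc (-1/2 : ℝ) (1/2) ×ˢ Set.Icc (-1/2 : ℝ) (1/2)) ∧ x = of r - of r'} ∪
          {x | x ∈ newtonLeibnizRel ∧ ∃ (n : ℕ) (r : IntegralRep (n + 3)) (r' : IntegralRep (n + 2)),
            x = of r - of r'}) :=
  betaCancellation_iff_ayoubPiCancellation.trans ayoubPiCancellation_iff_squareReduction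

end Summit.KontsevichZagierPeriods.KontsevichZagierPeriods.BetaCancellationLine
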